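import Literature.AlgebraicGeometry.Resolution.AlterationsDimension
import Literature.AlgebraicGeometry.Resolution.QuadraticTransformsUFD
import Literature.AlgebraicGeometry.Resolution.ResolutionOfSingularities
import Mathlib.AlgebraicGeometry.Morphisms.FiniteType
import HarnessLib

/-!
# Route `RadicialJung`, crux `CleanModels` (stmt-15917): the ring data of an affine chart of a regular surface —
# piece (S1b) of T2 brick B3 (`S1-SPEC.md` of res-L0-w81-pv-2 g5)

Support file (OURS) for PROGRAMME-clean-dim2 / T2 (`HOME/L/res-L0-w81-pv-2/g5/T2-ARCHITECTURE.md`, brick **B3**,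
chart construction (S1), piece **(S1b)** `chart_ring_data_of_isAffineOpen`); hand res-L0-w44-stub-4 g8 (custody
res-plan-2 IDLE POOL DEAL #64 (1)); line `via-clean-models` of the crux `DescentPerfectToAll` (stmt-0549).  Nothing
here is a statement of Hironaka's manuscript.  AI-written; AI review weaker than expert review; def-free, fact-free.

For an integral scheme `X`, locally of finite type over a field `k` (`q : X ⟶ Spec k`), and a NON-EMPTY affine open
`U ⊆ X`, the ring `A := Γ(X, U)` has exactly the four properties the B3 assembly
`finite_setOf_isGiraudSingularPoint_of_charts` (FILE 5, p563225: binders `hdom`, `hnoeth`, `hdim`, `h1`) asks of an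
adapted chart:

* `isDomain_sections_of_nonempty` — `A` is a domain (Mathlib `IsIntegral.component_integral`);
* `isNoetherianRing_sections_of_isAffineOpen` — `A` is Noetherian (a finitely generated `k`-algebra:
  `HasRingHomProperty.appLE` for `LocallyOfFiniteType`);
* `ringKrullDim_sections_le_of_isAffineOpen` — `dim A = dim X` (tree `topologicalKrullDim_eq_ringKrullDim_of_isAffineOpen`,
  Görtz–Wedhorn Thm. 5.22 (1)), so `dim A ≤ 2` when `dim X = 2`;
* `isPrincipalIdealRing_localization_of_height_eq_one` — if `X` is REGULAR, `A_𝔭` is a principal ideal ring for every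
  prime `𝔭` of height one: `A_𝔭 ≅ 𝒪_{X,ξ}` for the point `ξ ∈ U` of `𝔭` (`IsAffineOpen.isLocalization_stalk'`), a regular
  local ring of dimension `height 𝔭 = 1`, hence a DVR/PIR (tree `isPrincipalIdealRing_of_ringKrullDim_le_one`);
* `chart_ring_data_of_isAffineOpen` — the four packaged as one conjunction.

References: U. Görtz, T. Wedhorn, *Algebraic Geometry I* (2020), Thm. 5.22 [`GortzWedhorn2020`]; H. Matsumura,
*Commutative Ring Theory* (1986), Thm. 11.2 / §14 [`Matsumura1987`].
-/

noncomputable section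

set_option linter.dupNamespace false -- mandated namespace of this single-conjunct summit

open CategoryTheory AlgebraicGeometry TopologicalSpace IsLocalRing
open Literature.AlgebraicGeometry.Resolution

namespace Summit.ResolutionOfSingularities.ResolutionOfSingularities.Theorems.RadicialJung.CleanModels

universe u

section Chart

variable {X : Scheme.{u}} [IsIntegral X] {U : X.Opens}

/-- The sections of an integral scheme over a non-empty open form a domain. [folklore] -/
theorem isDomain_sections_of_nonempty (hne : (U : Set X).Nonempty) : IsDomain Γ(X, U) := by
  haveI : Nonempty U := hne.to_subtype
  infer_instance

omit [IsIntegral X] in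
/-- The sections over an affine open of a scheme locally of finite type over a field form a finitely generated
algebra over the field, hence a Noetherian ring. [cite: GortzWedhorn2020, Prop. 10.6 and Thm. 5.22] -/
theorem isNoetherianRing_sections_of_isAffineOpen {k : Type u} [Field k] (q : X ⟶ Spec (.of k))
    [LocallyOfFiniteType q] (hU : IsAffineOpen U) : IsNoetherianRing Γ(X, U) := by
  let φ : k →+* Γ(X, U) := (q.appLE ⊤ U le_top).hom.comp (Scheme.ΓSpecIso (.of k)).inv.hom
  have hφ : φ.FiniteType := by
    refine RingHom.FiniteType.comp ?_ (RingHom.FiniteType.of_surjective _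
      (Scheme.ΓSpecIso (.of k)).symm.commRingCatIsoToRingEquiv.surjective)
    exact HasRingHomProperty.appLE @LocallyOfFiniteType q ‹_› ⟨⊤, isAffineOpen_top _⟩ ⟨U, hU⟩ le_top
  letI := φ.toAlgebra
  haveI : Algebra.FiniteType k Γ(X, U) := hφ
  exact Algebra.FiniteType.isNoetherianRing k _

/-- **`dim Γ(X, U) ≤ 2`** for a non-empty affine open of an integral surface locally of finite type over a field
(in fact `dim Γ(X, U) = dim X`). [cite: GortzWedhorn2020, Thm. 5.22 (1)] -/
theorem ringKrullDim_sections_le_of_isAffineOpen {k : Type u} [Field k] (q : X ⟶ Spec (.of k))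
    [LocallyOfFiniteType q] (hU : IsAffineOpen U) (hne : (U : Set X).Nonempty) (hdim : topologicalKrullDim X = 2) :
    ringKrullDim Γ(X, U) ≤ 2 :=
  ((topologicalKrullDim_eq_ringKrullDim_of_isAffineOpen q hU hne).symm.trans hdim).le

omit [IsIntegral X] in
/-- **Height-one localizations of an affine chart of a REGULAR scheme are principal ideal rings**: for
`𝔭 ⊆ Γ(X, U)` prime of height one, `Γ(X, U)_𝔭 ≅ 𝒪_{X,ξ}` (`ξ ∈ U` the point of `𝔭`) is a regular local ring of
dimension one, i.e. a discrete valuation ring. [cite: Matsumura1987, Thm. 11.2] -/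
theorem isPrincipalIdealRing_localization_of_height_eq_one (hU : IsAffineOpen U) (hreg : Scheme.IsRegular X)
    (p : PrimeSpectrum Γ(X, U)) (hp : p.asIdeal.height = 1) :
    IsPrincipalIdealRing (Localization.AtPrime p.asIdeal) := by
  -- the point of `U` defined by `p`
  have hy : hU.fromSpec.base p ∈ U := by
    rw [← SetLike.mem_coe, ← hU.range_fromSpec]
    exact ⟨p, rfl⟩
  letI : Algebra Γ(X, U) (X.presheaf.stalk (hU.fromSpec.base p)) :=
    X.presheaf.algebra_section_stalk (⟨hU.fromSpec.base p, hy⟩ : (U : X.Opens))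
  haveI : IsLocalization.AtPrime (X.presheaf.stalk (hU.fromSpec.base p)) p.asIdeal :=
    hU.isLocalization_stalk' p hy
  haveI : IsRegularLocalRing (X.presheaf.stalk (hU.fromSpec.base p)) := hreg _
  -- transfer regularity to the standard localization
  let e : Localization.AtPrime p.asIdeal ≃ₐ[Γ(X, U)] X.presheaf.stalk (hU.fromSpec.base p) :=
    IsLocalization.algEquiv p.asIdeal.primeCompl _ _
  haveI : IsRegularLocalRing (Localization.AtPrime p.asIdeal) :=
    IsRegularLocalRing.of_ringEquiv e.symm.toRingEquiv
  apply isPrincipalIdealRing_of_ringKrullDim_le_one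
  rw [IsLocalization.AtPrime.ringKrullDim_eq_height p.asIdeal (Localization.AtPrime p.asIdeal), hp]
  exact le_rfl

/-- **(S1b) — THE RING DATA OF AN AFFINE CHART**, in the binder shape of FILE 5
`finite_setOf_isGiraudSingularPoint_of_charts` (`hdom`, `hnoeth`, `hdim`, `h1`): for `X` integral, regular, of
dimension `2`, locally of finite type over a field, and `U` a non-empty affine open, `Γ(X, U)` is a Noetherian domain of
dimension `≤ 2` whose height-one localizations are principal ideal rings. [this work] -/
theorem chart_ring_data_of_isAffineOpen {k : Type u} [Field k] (q : X ⟶ Spec (.of k)) [LocallyOfFiniteType q]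
    (hU : IsAffineOpen U) (hreg : Scheme.IsRegular X) (hdim : topologicalKrullDim X = 2)
    (hne : (U : Set X).Nonempty) :
    IsDomain Γ(X, U) ∧ IsNoetherianRing Γ(X, U) ∧ ringKrullDim Γ(X, U) ≤ 2 ∧
      ∀ p : PrimeSpectrum Γ(X, U), p.asIdeal.height = 1 → IsPrincipalIdealRing (Localization.AtPrime p.asIdeal) :=
  ⟨isDomain_sections_of_nonempty hne, isNoetherianRing_sections_of_isAffineOpen q hU,
    ringKrullDim_sections_le_of_isAffineOpen q hU hne hdim,
    isPrincipalIdealRing_localization_of_height_eq_one hU hreg⟩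

end Chart

end Summit.ResolutionOfSingularities.ResolutionOfSingularities.Theorems.RadicialJung.CleanModels

end
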